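import Summits.Ventures.QEC.Census.FoldFiber2
import HarnessLib

/-!
# Fold enumeration — torus translations (index arithmetic and invariance)

Cell `qec`, PARTITION row type-11 ("kernel C"), soundness layer 5 of `Census/FoldDefs.lean`.  The
translation `transIdx l m da db` of the two-block torus `ℤ_l × ℤ_m` (qubit `(blk,a,b) ↦ (blk, a+da, b+db)`)
and the induced word map `transW`: range and injectivity on the window, composition / identity
(`transIdx_comp`, `transW_transW`), weight invariance (`popc_transW`), equivariance of the fold
(`foldIdx_transIdx`, `foldW_transW`), invariance of the kernel given the (per-level decided) column
equivariance, translation-closure of `Matched`, and transport of `GoodFib` along small translations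
(`goodFib_of_trans`).  Elementary modular arithmetic.
-/

namespace Summit.Ventures.QEC.Census.Fold

open Summit.Ventures.QEC.Census

/-! ## Coordinates on the torus -/

/-- Coordinates of a flat index: `J = blk·(l m) + a·m + b`. -/
theorem idx_decomp (l m J : ℕ) : J = J / (l * m) * (l * m) + (J % (l * m) / m * m + J % (l * m) % m) := by
  have h1 := Nat.div_add_mod J (l * m)
  have h2 := Nat.div_add_mod (J % (l * m)) m
  rw [Nat.mul_comm] at h1 h2
  omega

/-- `coord_a_lt`: coord a lt (auxiliary lemma of the fold-certificate soundness chain). -/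
theorem coord_a_lt {l m J : ℕ} (hm : 0 < m) (hl : 0 < l) : J % (l * m) / m < l := by
  rw [Nat.div_lt_iff_lt_mul hm]
  exact Nat.mod_lt J (Nat.mul_pos hl hm)

/-- `lt_lm`: lt lm (auxiliary lemma of the fold-certificate soundness chain). -/
theorem lt_lm {l m B C : ℕ} (hB : B < l) (hC : C < m) : B * m + C < l * m := by
  calc B * m + C < B * m + m := by omega
    _ = (B + 1) * m := by ring
    _ ≤ l * m := Nat.mul_le_mul_right _ hB

/-- `transIdx_eq`: transIdx eq (auxiliary lemma of the fold-certificate soundness chain). -/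
theorem transIdx_eq (l m da db J : ℕ) :
    transIdx l m da db J = J / (l * m) * (l * m) + (J % (l * m) / m + da) % l * m + (J % (l * m) % m + db) % m := rfl

/-- `Geo.foldIdx_eq`: foldIdx eq (auxiliary lemma of the fold-certificate soundness chain). -/
theorem Geo.foldIdx_eq (G : Geo) (J : ℕ) :
    G.foldIdx J = J / (G.l * G.m) * (G.ls * G.ms) + J % (G.l * G.m) / G.m % G.ls * G.ms + J % (G.l * G.m) % G.m % G.ms :=
  rfl

/-- `coord_b_lt`: coord b lt (auxiliary lemma of the fold-certificate soundness chain). -/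
theorem coord_b_lt {l m J : ℕ} (hm : 0 < m) : J % (l * m) % m < m := Nat.mod_lt _ hm

/-- `coord_blk_lt`: coord blk lt (auxiliary lemma of the fold-certificate soundness chain). -/
theorem coord_blk_lt {l m J : ℕ} (hl : 0 < l) (hm : 0 < m) (hJ : J < 2 * (l * m)) : J / (l * m) < 2 := by
  rw [Nat.div_lt_iff_lt_mul (Nat.mul_pos hl hm)]; omega

/-- Recombining coordinates: the index with coordinates `(A, B, C)`, `B < l`, `C < m`, has these coordinates. -/
theorem coords_of_mk {l m A B C : ℕ} (hl : 0 < l) (hm : 0 < m) (hB : B < l) (hC : C < m) :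
    (A * (l * m) + B * m + C) / (l * m) = A ∧ (A * (l * m) + B * m + C) % (l * m) / m = B ∧
      (A * (l * m) + B * m + C) % (l * m) % m = C := by
  have hlm : 0 < l * m := Nat.mul_pos hl hm
  have hlt : B * m + C < l * m := by
    calc B * m + C < B * m + m := by omega
      _ = (B + 1) * m := by ring
      _ ≤ l * m := Nat.mul_le_mul_right _ hB
  have e1 : A * (l * m) + B * m + C = (l * m) * A + (B * m + C) := by ring
  rw [e1, Nat.mul_add_div hlm, Nat.mul_add_mod, Nat.div_eq_of_lt hlt, Nat.add_zero, Nat.mod_eq_of_lt hlt]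
  refine ⟨rfl, ?_, ?_⟩
  · rw [show B * m + C = m * B + C from by ring, Nat.mul_add_div hm, Nat.div_eq_of_lt hC, Nat.add_zero]
  · rw [show B * m + C = m * B + C from by ring, Nat.mul_add_mod, Nat.mod_eq_of_lt hC]

/-- `mk_lt`: mk lt (auxiliary lemma of the fold-certificate soundness chain). -/
theorem mk_lt {l m A B C : ℕ} (hA : A < 2) (hB : B < l) (hC : C < m) : A * (l * m) + B * m + C < 2 * (l * m) := by
  have hlt : B * m + C < l * m := by
    calc B * m + C < B * m + m := by omega
      _ = (B + 1) * m := by ring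
      _ ≤ l * m := Nat.mul_le_mul_right _ hB
  have : A * (l * m) ≤ 1 * (l * m) := Nat.mul_le_mul_right _ (by omega)
  omega

/-! ## `transIdx` -/

section Trans

variable {l m : ℕ} (hl : 0 < l) (hm : 0 < m)
include hl hm

/-- `transIdx_lt`: transIdx lt (auxiliary lemma of the fold-certificate soundness chain). -/
theorem transIdx_lt (da db : ℕ) {J : ℕ} (hJ : J < 2 * (l * m)) : transIdx l m da db J < 2 * (l * m) :=
  mk_lt (coord_blk_lt hl hm hJ) (Nat.mod_lt _ hl) (Nat.mod_lt _ hm)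

/-- Coordinates of a translated index. -/
theorem coords_transIdx (da db J : ℕ) :
    transIdx l m da db J / (l * m) = J / (l * m) ∧
      transIdx l m da db J % (l * m) / m = (J % (l * m) / m + da) % l ∧
      transIdx l m da db J % (l * m) % m = (J % (l * m) % m + db) % m :=
  coords_of_mk hl hm (Nat.mod_lt _ hl) (Nat.mod_lt _ hm)

/-- COMPOSITION: translating by `(da', db')` then by `(da, db)` is translating by the sum. -/
theorem transIdx_comp (da db da' db' J : ℕ) :
    transIdx l m da db (transIdx l m da' db' J) = transIdx l m (da + da') (db + db') J := by
  obtain ⟨h1, h2, h3⟩ := coords_transIdx hl hm da' db' J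
  rw [transIdx_eq l m da db, h1, h2, h3, transIdx_eq l m (da + da'), Nat.mod_add_mod, Nat.mod_add_mod,
    show J % (l * m) / m + da' + da = J % (l * m) / m + (da + da') from by omega,
    show J % (l * m) % m + db' + db = J % (l * m) % m + (db + db') from by omega]

/-- IDENTITY on the window. -/
theorem transIdx_zero {J : ℕ} (_hJ : J < 2 * (l * m)) : transIdx l m 0 0 J = J := by
  rw [transIdx_eq]
  simp only [Nat.add_zero]
  rw [Nat.mod_eq_of_lt (coord_a_lt hm hl), Nat.mod_eq_of_lt (coord_b_lt hm)]
  have := idx_decomp l m J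
  omega

omit hl hm in
/-- PERIODICITY. -/
theorem transIdx_mod (da db J : ℕ) : transIdx l m (da % l) (db % m) J = transIdx l m da db J := by
  rw [transIdx_eq, transIdx_eq, Nat.add_mod_mod, Nat.add_mod_mod]

/-- INJECTIVITY on the window. -/
theorem transIdx_inj (da db : ℕ) {J J' : ℕ} (hJ : J < 2 * (l * m)) (hJ' : J' < 2 * (l * m))
    (h : transIdx l m da db J = transIdx l m da db J') : J = J' := by
  -- apply the inverse translation
  have := congrArg (transIdx l m (l - da % l) (m - db % m)) h
  rw [← transIdx_mod da db J, ← transIdx_mod da db J', transIdx_comp hl hm, transIdx_comp hl hm,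
    show l - da % l + da % l = l from Nat.sub_add_cancel (Nat.mod_lt _ hl).le,
    show m - db % m + db % m = m from Nat.sub_add_cancel (Nat.mod_lt _ hm).le,
    ← transIdx_mod l m J, ← transIdx_mod l m J', Nat.mod_self, Nat.mod_self,
    transIdx_zero hl hm hJ, transIdx_zero hl hm hJ'] at this
  exact this

/-! ## `transW` -/

omit hl hm in
/-- `transW_xor`: transW xor (auxiliary lemma of the fold-certificate soundness chain). -/
theorem transW_xor (da db u v : ℕ) : transW l m da db (u ^^^ v) = transW l m da db u ^^^ transW l m da db v :=
  lin_xor _ _ _ _ _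

/-- `transW_lt`: transW lt (auxiliary lemma of the fold-certificate soundness chain). -/
theorem transW_lt (da db u : ℕ) : transW l m da db u < 2 ^ (2 * (l * m)) :=
  lin_lt_two_pow _ _ _ (fun J hJ => Nat.pow_lt_pow_right (by norm_num) (transIdx_lt hl hm da db hJ)) u

omit hl hm in
/-- `transW_two_pow`: transW two pow (auxiliary lemma of the fold-certificate soundness chain). -/
theorem transW_two_pow (da db : ℕ) {J : ℕ} (hJ : J < 2 * (l * m)) :
    transW l m da db (2 ^ J) = 2 ^ transIdx l m da db J := by
  rw [transW, lin_two_pow _ _ 0 J hJ, Nat.zero_add]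

/-- Weight invariance. -/
theorem popc_transW (da db u : ℕ) : popc (2 * (l * m)) (transW l m da db u) = popc (2 * (l * m)) u :=
  popc_lin_pow_inj _ _ _ _ (fun _ _ h₁ h₂ h => transIdx_inj hl hm da db h₁ h₂ h) (fun _ hk => transIdx_lt hl hm da db hk)

/-- Composition of word translations. -/
theorem transW_transW (da db da' db' u : ℕ) :
    transW l m da db (transW l m da' db' u) = transW l m (da + da') (db + db') u := by
  rw [transW, transW, lin_lin, transW]
  exact lin_congr (i0 := 0) (fun J hJ => by
    rw [Nat.zero_add, lin_two_pow _ _ 0 _ (transIdx_lt hl hm da' db' hJ), Nat.zero_add, transIdx_comp hl hm]) u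

omit hl hm in
/-- `transW_mod`: transW mod (auxiliary lemma of the fold-certificate soundness chain). -/
theorem transW_mod (da db u : ℕ) : transW l m (da % l) (db % m) u = transW l m da db u :=
  lin_congr (i0 := 0) (fun J _ => by rw [transIdx_mod]) u

/-- `transW_zero`: transW zero (auxiliary lemma of the fold-certificate soundness chain). -/
theorem transW_zero {u : ℕ} (hu : u < 2 ^ (2 * (l * m))) : transW l m 0 0 u = u := by
  rw [transW, lin_congr (i0 := 0) (h := fun J => 2 ^ J) (fun J hJ => by rw [Nat.zero_add, transIdx_zero hl hm hJ]) u,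
    lin_pow_self, Nat.mod_eq_of_lt hu]

/-- Undoing a translation. -/
theorem transW_inv {u : ℕ} (hu : u < 2 ^ (2 * (l * m))) (da db : ℕ) :
    transW l m (l - da % l) (m - db % m) (transW l m da db u) = u := by
  rw [← transW_mod da db u, transW_transW hl hm,
    show l - da % l + da % l = l from Nat.sub_add_cancel (Nat.mod_lt _ hl).le,
    show m - db % m + db % m = m from Nat.sub_add_cancel (Nat.mod_lt _ hm).le,
    ← transW_mod l m u, Nat.mod_self, Nat.mod_self, transW_zero hl hm hu]

/-- `Matched` is closed under un-translating. -/
theorem matched_of_matched_transW {reps : List ℕ} {da db u : ℕ} (h : Matched l m reps (transW l m da db u)) :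
    Matched l m reps u := by
  obtain ⟨r, hr, da', db', h⟩ := h
  exact ⟨r, hr, da' + da, db' + db, by rw [← transW_transW hl hm, h]⟩

end Trans

/-! ## Equivariance of the fold and invariance of the kernel -/

namespace Geo

/-- Parity data of a fold step used by the translation lemmas: positive periods and the folded axis even. -/
structure Shape (G : Geo) : Prop where
  l_pos : 0 < G.l
  m_pos : 0 < G.m
  ax_even : (G.ax = true → G.l = 2 * G.ls) ∧ (G.ax = false → G.m = 2 * G.ms)

/-- `Shape.ls_pos`: ls pos (auxiliary lemma of the fold-certificate soundness chain). -/
theorem Shape.ls_pos {G : Geo} (h : G.Shape) : 0 < G.ls := by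
  have := h.l_pos; have h2 := h.ax_even
  unfold ls at *
  cases hax : G.ax <;> simp [hax] at h2 ⊢ <;> omega

/-- `Shape.ms_pos`: ms pos (auxiliary lemma of the fold-certificate soundness chain). -/
theorem Shape.ms_pos {G : Geo} (h : G.Shape) : 0 < G.ms := by
  have := h.m_pos; have h2 := h.ax_even
  unfold ms at *
  cases hax : G.ax <;> simp [hax] at h2 ⊢ <;> omega

/-- `Shape.ls_dvd`: ls dvd (auxiliary lemma of the fold-certificate soundness chain). -/
theorem Shape.ls_dvd {G : Geo} (h : G.Shape) : G.ls ∣ G.l := by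
  have h2 := h.ax_even
  cases hax : G.ax
  · simp [ls, hax]
  · exact ⟨2, by rw [h2.1 hax]; ring⟩

/-- `Shape.ms_dvd`: ms dvd (auxiliary lemma of the fold-certificate soundness chain). -/
theorem Shape.ms_dvd {G : Geo} (h : G.Shape) : G.ms ∣ G.m := by
  have h2 := h.ax_even
  cases hax : G.ax
  · exact ⟨2, by rw [h2.2 hax]; unfold ms; simp [hax]; ring⟩
  · simp [ms, hax]

/-- `n_eq`: n eq (auxiliary lemma of the fold-certificate soundness chain). -/
theorem n_eq (G : Geo) : G.n = 2 * (G.l * G.m) := rfl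
/-- `ns_eq`: ns eq (auxiliary lemma of the fold-certificate soundness chain). -/
theorem ns_eq (G : Geo) : G.ns = 2 * (G.ls * G.ms) := rfl

/-- FOLD EQUIVARIANCE on indices. -/
theorem foldIdx_transIdx {G : Geo} (h : G.Shape) (da db : ℕ) {J : ℕ} (_hJ : J < G.n) :
    G.foldIdx (transIdx G.l G.m da db J) = transIdx G.ls G.ms da db (G.foldIdx J) := by
  obtain ⟨h1, h2, h3⟩ := coords_transIdx h.l_pos h.m_pos da db J
  have hc := coords_of_mk (l := G.ls) (m := G.ms) (A := J / (G.l * G.m)) h.ls_pos h.ms_pos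
    (Nat.mod_lt (J % (G.l * G.m) / G.m) h.ls_pos) (Nat.mod_lt (J % (G.l * G.m) % G.m) h.ms_pos)
  rw [Geo.foldIdx_eq, h1, h2, h3, transIdx_eq, Geo.foldIdx_eq, hc.1, hc.2.1, hc.2.2,
    Nat.mod_mod_of_dvd _ h.ls_dvd, Nat.mod_mod_of_dvd _ h.ms_dvd, Nat.mod_add_mod, Nat.mod_add_mod]

/-- FOLD EQUIVARIANCE on words. -/
theorem foldW_transW {G : Geo} (h : G.Shape) (hG : G.OK) (da db u : ℕ) :
    G.foldW (transW G.l G.m da db u) = transW G.ls G.ms da db (G.foldW u) := by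
  have e1 : G.foldW (transW G.l G.m da db u) = lin (fun k => 2 ^ G.foldIdx (transIdx G.l G.m da db k)) G.n 0 u := by
    rw [Geo.foldW, transW, lin_lin]
    exact lin_congr (i0 := 0) (fun J hJ => by
      have := lin_two_pow (fun J => 2 ^ G.foldIdx J) G.n 0 _ (transIdx_lt h.l_pos h.m_pos da db hJ)
      rw [Nat.zero_add] at this ⊢
      exact this) u
  have e2 : transW G.ls G.ms da db (G.foldW u) = lin (fun k => 2 ^ transIdx G.ls G.ms da db (G.foldIdx k)) G.n 0 u := by
    rw [Geo.foldW, map_lin_of_xor (transW G.ls G.ms da db) (lin_zero _ _ _) (transW_xor da db)]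
    exact lin_congr (i0 := 0) (fun J hJ => by
      rw [Nat.zero_add, transW_two_pow da db (hG.foldIdx_lt J hJ)]) u
  rw [e1, e2]
  exact lin_congr (i0 := 0) (fun J hJ => by rw [Nat.zero_add, foldIdx_transIdx h da db hJ]) u

end Geo

/-- Row translation as a word map on the checks of `ℤ_l × ℤ_m` (one block). -/
def transRowW (l m da db y : ℕ) : ℕ := lin (fun R => 2 ^ transRow l m da db R) (l * m) 0 y

/-- Column equivariance of a two-block torus code under one translation `(da, db)` (decided per level for
the two generators): translating the qubit translates the check pattern. -/
def TCode.ColEquiv (C : TCode) (da db : ℕ) : Prop :=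
  ∀ J, J < C.n → C.col (transIdx C.l C.m da db J) = transRowW C.l C.m da db (C.col J)

/-- Row translation fixes only zero... : it is injective as a bit placement, so a word is `0` iff its
translate is. -/
theorem transRowW_eq_zero_iff {l m : ℕ} (hl : 0 < l) (hm : 0 < m) (da db : ℕ) {y : ℕ} (hy : y < 2 ^ (l * m)) :
    transRowW l m da db y = 0 ↔ y = 0 := by
  constructor
  · intro h
    -- popcount preserved under the injective placement
    have hinj : ∀ k₁ k₂, k₁ < l * m → k₂ < l * m → transRow l m da db k₁ = transRow l m da db k₂ → k₁ = k₂ := by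
      intro k₁ k₂ h₁ h₂ he
      -- transRow is transIdx on block 0
      have e : ∀ k, k < l * m → transRow l m da db k = transIdx l m da db k := by
        intro k hk
        unfold transRow transIdx
        rw [Nat.div_eq_of_lt hk, Nat.mod_eq_of_lt hk]; simp
      rw [e k₁ h₁, e k₂ h₂] at he
      exact transIdx_inj hl hm da db (by omega) (by omega) he
    have hlt : ∀ k, k < l * m → transRow l m da db k < l * m := by
      intro k _
      unfold transRow
      exact lt_lm (Nat.mod_lt (k / m + da) hl) (Nat.mod_lt (k % m + db) hm)
    have hp := popc_lin_pow_inj (fun R => transRow l m da db R) (l * m) (l * m) y hinj hlt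
    rw [transRowW] at h
    rw [h, popc_zero] at hp
    -- popc y = 0 with y < 2^(lm) ⇒ y = 0
    by_contra hne
    obtain ⟨i, hi⟩ := Nat.exists_testBit_of_ne_zero hne
    have him : i < l * m := by
      by_contra hge; rw [not_lt] at hge
      rw [Nat.testBit_lt_two_pow (lt_of_lt_of_le hy (Nat.pow_le_pow_right (by norm_num) hge))] at hi
      exact Bool.false_ne_true hi
    have : 0 < popc (l * m) y := by
      rw [popc_eq_card]
      exact Finset.card_pos.2 ⟨i, by simp [him, hi]⟩
    omega
  · intro h; rw [h, transRowW, lin_zero]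

/-- The syndrome of a translated word is the row-translated syndrome (column-equivariant translation). -/
theorem TCode.syn_transW (C : TCode) (hl : 0 < C.l) (hm : 0 < C.m) {da db : ℕ} (heq : C.ColEquiv da db) (u : ℕ) :
    lin C.col C.n 0 (transW C.l C.m da db u) = transRowW C.l C.m da db (lin C.col C.n 0 u) := by
  rw [transW, lin_lin, map_lin_of_xor (transRowW C.l C.m da db) (lin_zero _ _ _) (fun a b => lin_xor _ _ _ _ _)]
  exact lin_congr (i0 := 0) (fun J hJ => by
    have := lin_two_pow C.col C.n 0 _ (transIdx_lt hl hm da db hJ)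
    rw [Nat.zero_add] at this ⊢
    rw [this, heq J hJ]) u

/-- `lin` maps with coefficients agreeing below `n₁` agree on words `< 2^{n₁}` (window extension). -/
theorem lin_eq_lin_of_lt {n₁ n₂ : ℕ} (g₁ g₂ : ℕ → ℕ) {z : ℕ} (hz : z < 2 ^ n₁) (hle : n₁ ≤ n₂)
    (hg : ∀ k, k < n₁ → g₁ k = g₂ k) : lin g₁ n₁ 0 z = lin g₂ n₂ 0 z := by
  conv_lhs => rw [← Nat.mod_eq_of_lt hz, ← lin_pow_self, map_lin_of_xor (lin g₁ n₁ 0) (lin_zero _ _ _) (lin_xor _ _ _)]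
  conv_rhs => rw [← Nat.mod_eq_of_lt hz, ← lin_pow_self, map_lin_of_xor (lin g₂ n₂ 0) (lin_zero _ _ _) (lin_xor _ _ _)]
  exact lin_congr (i0 := 0) (fun k hk => by
    rw [Nat.zero_add, lin_two_pow _ _ 0 _ hk, lin_two_pow _ _ 0 _ (lt_of_lt_of_le hk hle), Nat.zero_add, hg k hk]) z

/-- Kernel invariance under a column-equivariant translation. -/
theorem TCode.ker_transW_iff (C : TCode) (hl : 0 < C.l) (hm : 0 < C.m) {da db : ℕ} (heq : C.ColEquiv da db)
    (hcol : ∀ J, J < C.n → C.col J < 2 ^ (C.l * C.m)) (u : ℕ) :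
    C.ker C.n (transW C.l C.m da db u) ↔ C.ker C.n u := by
  unfold TCode.ker
  rw [C.syn_transW hl hm heq u]
  exact transRowW_eq_zero_iff hl hm da db (lin_lt_two_pow _ _ _ hcol u)

/-! ## Transport of `GoodFib` along small translations -/

/-- If `Q` is closed under un-translating big words and the kernel/fold facts hold, `GoodFib` of a
translated small word gives `GoodFib` of the word. -/
theorem goodFib_of_trans {G : Geo} (hS : G.Shape) (hG : G.OK) {C : TCode} (hC : C.l = G.l ∧ C.m = G.m)
    {da db : ℕ} (heq : C.ColEquiv da db) (hcol : ∀ J, J < C.n → C.col J < 2 ^ (C.l * C.m))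
    {W : ℕ} {Q : ℕ → Prop} (hQ : ∀ u, Q (transW G.l G.m da db u) → Q u) {v : ℕ}
    (h : GoodFib G C W Q (transW G.ls G.ms da db v)) : GoodFib G C W Q v := by
  intro u hu hker hwt hfold
  have hl : 0 < G.l := hS.l_pos
  have hm : 0 < G.m := hS.m_pos
  have hn : C.n = G.n := by rw [TCode.n, Geo.n, hC.1, hC.2]
  apply hQ u
  refine h (transW G.l G.m da db u) ?_ ?_ ?_ ?_
  · rw [Geo.n]; exact transW_lt hl hm da db u
  · rw [← hn, ← hC.1, ← hC.2, TCode.ker_transW_iff C (hC.1 ▸ hl) (hC.2 ▸ hm) heq hcol]; rw [hn]; exact hker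
  · rw [Geo.n, popc_transW hl hm]; exact hwt
  · rw [Geo.foldW_transW hS hG, hfold]

end Summit.Ventures.QEC.Census.Fold
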